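import Literature.AlgebraicGeometry.Resolution.ProperModelsModification
import Literature.AlgebraicGeometry.Resolution.ProperModelsPatching
import Literature.AlgebraicGeometry.Resolution.ZariskiPatchingProperModels
import Literature.AlgebraicGeometry.Resolution.AlterationsResolution
import Literature.AlgebraicGeometry.Resolution.ResolutionGlue
import Literature.AlgebraicGeometry.Resolution.ResolutionLU
import HarnessLib

/-!
# Two-model patching, RegLe-ification and local RegLe-ification of proper models follow from
# resolution of singularities; two-model patching ∧ local uniformization ⟺ resolution

Topic: `Literature/AlgebraicGeometry/Resolution`. The patching statements of
`ProperModelsPatching.lean` — Piltant's two-model patching `ProperModel.TwoModelPatching p`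
(Piltant 2013, Prop. 5.1 with `P = P_reg`, for proper models), its one-morphism form
`ProperModel.RegLeification p` and the pre-compactification form
`ProperModel.LocalRegLeification p` — are the open core of the implication "local uniformization
⇒ resolution of singularities" in characteristic `p` (`resolutionInChar_of_properTwoModelPatching_of_relLU`,
`ZariskiPatchingProperModels.lean`: two-model patching + relative LU ⇒ `ResolutionInChar p`, Zariski
1944 / Piltant 2013, Cor. 5.7). This file records the CONVERSE bookkeeping, all PROVED:

* `ProperModel.exists_hom_isRegular_of_hasResolution` — a resolution of singularities of a proper
  model `M` is a REGULAR proper model dominating `M` (`ProperModel.ofModification`; the source of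
  a proper birational morphism from a regular scheme onto an integral scheme is integral).
* `ProperModel.twoModelPatching_of_resolutionInChar`, `regLeification_of_resolutionInChar`,
  `localRegLeification_of_resolutionInChar` — each patching statement FOLLOWS from
  `ResolutionInChar p`: resolve the join (resp. the source) and note that a regular model is
  `RegLe` over every model it dominates.
* `ProperModel.resolutionInChar_iff_twoModelPatching_and_relLU` — hence
  `ResolutionInChar p ⟺ TwoModelPatching p ∧ LUrel_p` (relative local uniformization in
  characteristic `p`, the shape of `lurel_of_resolutionInChar`), and
  `twoModelPatching_iff_resolutionInChar_of_relLU` — under `LUrel_p`, two-model patching of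
  proper models is EQUIVALENT to resolution in characteristic `p`: Zariski's reduction of
  "LU ⇒ resolution" to the patching of two models (Zariski–Samuel II, Ch. VI §17; Piltant 2013,
  p. 2: "All of these problems are open in dimension four or more") loses nothing.

## References

* O. Zariski, *Reduction of the singularities of algebraic three dimensional varieties*, Ann. of
  Math. 45 (1944) 472–542, Fundamental Theorem p. 539 (via Piltant).
* O. Zariski, P. Samuel, *Commutative Algebra* II, Ch. VI §17. [ZariskiSamuel1960]
* O. Piltant, *An axiomatic version of Zariski's patching theorem*, RACSAM 107 (2013) 91–121,
  p. 2, Prop. 5.1, Cor. 5.7. [Piltant2013]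
-/

noncomputable section

open CategoryTheory AlgebraicGeometry TopologicalSpace IsLocalRing

namespace Literature.AlgebraicGeometry.Resolution

universe u

namespace ProperModel

variable {k K : Type u} [Field k] [Field K] [Algebra k K]

/-! ## Resolutions as regular dominating models -/

/-- **A resolution of singularities of a proper model is a regular proper model dominating it**
(the source of a proper birational morphism from a regular scheme onto `M` is integral,
`IsBirational.isIntegral`; it is a proper model dominating `M` by `ProperModel.ofModification`).
[cite: ZariskiSamuel1960, Ch. VI §17] -/
theorem exists_hom_isRegular_of_hasResolution (M : ProperModel k K)
    (h : Scheme.HasResolution M.X) :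
    ∃ (N : ProperModel k K) (_ : N.Hom M), Scheme.IsRegular N.X := by
  obtain ⟨Y, π, hπ⟩ := h
  haveI : IsProper π := hπ.isProper
  haveI : IsReduced Y := hπ.isRegular.isReduced
  haveI : IsIntegral Y := hπ.isBirational.isIntegral
  obtain ⟨U, hU, hiso⟩ := M.exists_nonempty_isIso_morphismRestrict hπ.isBirational
  haveI := hiso
  exact ⟨ofModification M π U hU, ofModificationHom M π U hU, hπ.isRegular⟩

/-- Under resolution of singularities in characteristic `p`, the scheme of every proper model
over a field of characteristic `p` has a resolution (it is integral and proper over `k`).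
[folklore] -/
theorem hasResolution_of_resolutionInChar {p : ℕ} (h : ResolutionInChar.{u} p)
    {k K : Type u} [Field k] [CharP k p] [Field K] [Algebra k K] (M : ProperModel k K) :
    Scheme.HasResolution M.X :=
  h k M.X M.π inferInstance inferInstance inferInstance inferInstance

/-! ## The patching statements follow from resolution -/

/-- **Two-model patching of proper models follows from resolution of singularities in
characteristic `p`**: resolve the join `M₁ ⋈ M₂` (`ProperModel.join`); a regular model is `RegLe`
over both. [folklore] -/
theorem twoModelPatching_of_resolutionInChar {p : ℕ} (h : ResolutionInChar.{u} p) :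
    TwoModelPatching.{u} p := by
  intro k _ _ K _ _ _ M₁ M₂
  obtain ⟨N, φ, hN⟩ := (join M₁ M₂).exists_hom_isRegular_of_hasResolution
    (hasResolution_of_resolutionInChar h _)
  exact ⟨N, φ.comp (joinFst M₁ M₂), φ.comp (joinSnd M₁ M₂), fun y _ => hN y, fun y _ => hN y⟩

/-- **RegLe-ification follows from resolution of singularities in characteristic `p`**: take
`ψ : M' → M` a resolution of `M`; `M'` being regular, `ψ` and `ψ ≫ φ` are `RegLe`. [folklore] -/
theorem regLeification_of_resolutionInChar {p : ℕ} (h : ResolutionInChar.{u} p) :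
    RegLeification.{u} p := by
  intro k _ _ K _ _ _ M Y φ
  obtain ⟨M', ψ, hM'⟩ := M.exists_hom_isRegular_of_hasResolution
    (hasResolution_of_resolutionInChar h _)
  exact ⟨M', ψ, fun y _ => hM' y, fun y _ => hM' y⟩

/-- **Local RegLe-ification follows from resolution of singularities in characteristic `p`**:
take `O = M` (the open `⊤`) and `N → M` a resolution. [folklore] -/
theorem localRegLeification_of_resolutionInChar {p : ℕ} (h : ResolutionInChar.{u} p) :
    LocalRegLeification.{u} p := by
  intro k _ _ K _ _ _ M Y φ
  obtain ⟨N, π, hπ⟩ := hasResolution_of_resolutionInChar h M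
  haveI : IsProper π := hπ.isProper
  haveI : IsReduced N := hπ.isRegular.isReduced
  haveI : IsIntegral N := hπ.isBirational.isIntegral
  let e : M.X ⟶ ((⊤ : M.X.Opens) : Scheme.{u}) := (Scheme.topIso M.X).inv
  exact ⟨⊤, N, π ≫ e, inferInstance, inferInstance, hπ.isBirational.comp_iso e,
    fun _ _ => trivial, fun _ _ => trivial, fun n _ => hπ.isRegular n, fun n _ => hπ.isRegular n⟩

/-! ## Two-model patching ∧ local uniformization ⟺ resolution -/

/-- **Resolution in characteristic `p` ⟺ two-model patching of proper models ∧ relative local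
uniformization in characteristic `p`** (`⇒`: `twoModelPatching_of_resolutionInChar` and
`lurel_of_resolutionInChar`; `⇐`: Zariski's programme with proper models,
`resolutionInChar_of_properTwoModelPatching_of_relLU`). [cite: Piltant2013, Prop. 5.1 and Cor. 5.7] -/
theorem resolutionInChar_iff_twoModelPatching_and_relLU {p : ℕ} (hp : p.Prime) :
    ResolutionInChar.{0} p ↔ TwoModelPatching.{0} p ∧
      ∀ (k K : Type) [Field k] [CharP k p] [Field K] [Algebra k K],
        (⊤ : IntermediateField k K).FG → ∀ O : ValuationSubring K,
          (∀ c : k, algebraMap k K c ∈ O) → ∀ R : Subalgebra k K, R.FG →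
            R.toSubring ≤ O.toSubring →
              ∃ (A : Subalgebra k K) (h : A.toSubring ≤ O.toSubring), R ≤ A ∧ A.FG ∧
                IsFractionRing A K ∧ IsRegularLocalRing (Localization.AtPrime
                  (Ideal.comap (Subring.inclusion h) (IsLocalRing.maximalIdeal O))) :=
  ⟨fun h => ⟨twoModelPatching_of_resolutionInChar h, lurel_of_resolutionInChar p hp h⟩,
    fun h => resolutionInChar_of_properTwoModelPatching_of_relLU h.1 h.2⟩

/-- **Under relative local uniformization in characteristic `p`, two-model patching of proper
models is equivalent to resolution of singularities in characteristic `p`**: Zariski's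
reduction of "LU ⇒ resolution" to the patching of two models loses nothing.
[cite: Piltant2013, p. 2 and Cor. 5.7] -/
theorem twoModelPatching_iff_resolutionInChar_of_relLU {p : ℕ}
    (hLU : ∀ (k K : Type) [Field k] [CharP k p] [Field K] [Algebra k K],
      (⊤ : IntermediateField k K).FG → ∀ O : ValuationSubring K,
        (∀ c : k, algebraMap k K c ∈ O) → ∀ R : Subalgebra k K, R.FG →
          R.toSubring ≤ O.toSubring →
            ∃ (A : Subalgebra k K) (h : A.toSubring ≤ O.toSubring), R ≤ A ∧ A.FG ∧
              IsFractionRing A K ∧ IsRegularLocalRing (Localization.AtPrime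
                (Ideal.comap (Subring.inclusion h) (IsLocalRing.maximalIdeal O)))) :
    TwoModelPatching.{0} p ↔ ResolutionInChar.{0} p :=
  ⟨fun hZ => resolutionInChar_of_properTwoModelPatching_of_relLU hZ hLU,
    twoModelPatching_of_resolutionInChar⟩

end ProperModel

end Literature.AlgebraicGeometry.Resolution

end
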